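import Summits.CriticalPhenomena.PercolationContinuityZ3.Theorems.Transplant.FKConnectivityAllQWheelTools
import HarnessLib

/-!
# Connectivity correlation inequalities for `φ_{w,q}`, every `q > 0` — WHEELS: adjacent-edge negative correlation at every rim
# vertex of every wheel `W_n` (`0 < q ≤ 1`, all weights)

Support file (`--supports stmt-CriticalPhenomena-4575`), FK sub-lane `prim-bschramm-fk-1` (gen 7) of the post-continuity
programme; builds on p205010 (kernel theorem, internal audit signed; external expert review pending).  No definitions, no named facts, no sorries; standard axioms (the combinatorial tools are in file 1, `…WheelTools`).

A wheel is presented by its hub `h` and a cyclic permutation `σ` of the rim (`σ.IsCycle`, `σ h = h`, at least three rim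
vertices): `wheelEdges h σ = {s(h, v), s(v, σ v) : σ v ≠ v}`.  THEOREM (`wheel_negCorr_at_rim`): for `0 < q ≤ 1`, every weight
vector supported in a wheel and every rim vertex `x`, each two of the three pairs `x σx`, `x σ⁻¹x`, `x h` are negatively
correlated under `φ_{w,q}`.  Proof: degree-three elimination (file `…DegThree`) at `x`; the rim–rim pair lands in the FAN
(spokes + rim path), which lies in a 2-tree (`isTwoTree_fanTree`), the two rim–spoke pairs land in the wheel with rim
`swap x (σ x) * σ` (the rim vertex `x` spliced out, chord `σ⁻¹x σx` added) — one rim vertex fewer, same vertex type — and the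
induction closes at `W₃ = K₄` (fk-1 g5's `edgeNegCorr_supp_K4`, Sokal's computation).  Wheels `W_n`, `n ≥ 4`, are 3-connected and
not in Wagner's two-sum stock (2-trees, `K₄`); the pairs at the HUB (degree `n`) are not reached by these reductions (for
consecutive spokes they follow on paper from the rim–rim case by planar self-duality of `W_n`, not formalised; non-consecutive
spoke pairs are dual-disjoint).  Negative correlation of adjacent edges for `φ_{p,q<1}` on general graphs is open in print
(Grimmett 2006 §3.9; Park, arXiv:2608.08565, p. 1). [cite: Grimmett2006, §3.9 eq. (3.94) (p. 63)] [cite: Wagner2006, Ex. 5.1, Thm. 5.8(d), §5.3]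
-/

noncomputable section

namespace Summit.CriticalPhenomena.PercolationContinuityZ3.Theorems

namespace FK

open MeasureTheory Set Literature.Probability.LatticeModels Literature.Probability.Percolation
open scoped Classical

variable {V : Type*} [Fintype V]

/-! ### The theorem: negative correlation of the pairs at every rim vertex of every wheel -/

/-- **Induction over the number of rim vertices.**  For `0 < q ≤ 1`, a wheel with hub `h` and rim cycle `σ` having `n ≥ 3` rim
vertices, and a rim vertex `x`: each two of the pairs `x σx`, `x σ⁻¹x`, `x h` are negatively correlated under every `φ_{w,q}`
supported in the wheel.  Rim–rim pair: degree-three elimination into the fan, a partial 2-tree; rim–spoke pairs: degree-three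
elimination into the wheel with `x` spliced out (`n − 1` rim vertices, induction); `n = 3`: `K₄`.
[cite: Grimmett2006, §3.9 eq. (3.94) (p. 63)] [cite: Wagner2006, Ex. 5.1, Thm. 5.8(d), §5.3] -/
theorem wheel_negCorr_rim_aux {q : ℝ} (hq0 : 0 < q) (hq1 : q ≤ 1) (n : ℕ) :
    ∀ (σ : Equiv.Perm V) (h : V), σ.IsCycle → σ h = h → σ.support.card = n → 3 ≤ n → ∀ x : V, σ x ≠ x →
      NegCorrPairSupp (wheelEdges h σ) q s(x, σ x) s(x, h) ∧
      NegCorrPairSupp (wheelEdges h σ) q s(x, σ.symm x) s(x, h) ∧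
      NegCorrPairSupp (wheelEdges h σ) q s(x, σ.symm x) s(x, σ x) := by
  induction n using Nat.strong_induction_on with
  | _ n ih =>
  intro σ h hσ hh hn h3 x hx
  -- distinctness of `x`, `a = σ⁻¹ x`, `b = σ x`, `h`
  have hffx : σ (σ x) ≠ x := apply_apply_ne_of_three_le hσ hn h3 hx
  have hxh : x ≠ h := ne_of_apply_eq_of_apply_ne hh hx
  have hbh : σ x ≠ h := ne_of_apply_eq_of_apply_ne hh (apply_ne hx)
  have hah : σ.symm x ≠ h := ne_of_apply_eq_of_apply_ne hh (symm_apply_ne hx)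
  have hab : σ.symm x ≠ σ x := symm_apply_ne_apply hσ hn h3 hx
  have hax : σ.symm x ≠ x := by
    intro hc; apply hx; conv_lhs => rw [← hc]; rw [Equiv.apply_symm_apply]
  have hbx : σ x ≠ x := hx
  have hS := fun e (he : e ∈ wheelEdges h σ) (hxe : x ∈ e) => eq_of_mem_wheelEdges_of_mem hh hx he hxe
  -- rim–rim pair: into the fan
  have c3 : NegCorrPairSupp (wheelEdges h σ) q s(x, σ.symm x) s(x, σ x) := by
    refine negCorrPairSupp_of_degree_three_of_edgeNegCorrSupp hq0 hq1 (u := h) hxh hax.symm hbx.symm hah hbh hab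
      (fun e he hxe => ?_) (edgeNegCorrSupp_of_isTwoTree hq0 hq1 (isTwoTree_fanTree hσ hh hn hx (n - 2) (by omega)))
      (fan_subset_fanTree hσ hn h3 hx)
    rcases hS e he hxe with h1 | h1 | h1
    · exact Or.inr (Or.inl h1)
    · exact Or.inl h1
    · exact Or.inr (Or.inr h1)
  rcases (show n = 3 ∨ 4 ≤ n by omega) with rfl | h4
  · -- `W₃ = K₄`: all pairs
    have hK := edgeNegCorrSupp_wheel_three hq0 hq1 hσ hh hn hx
    refine ⟨?_, ?_, c3⟩
    · exact negCorrPairSupp_of_edgeNegCorrSupp hK (by rw [Sym2.mk_isDiag_iff]; exact hbx.symm)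
        (sym2_mk_ne_mk_left hbh.symm)
    · exact negCorrPairSupp_of_edgeNegCorrSupp hK (by rw [Sym2.mk_isDiag_iff]; exact hax.symm)
        (sym2_mk_ne_mk_left hah.symm)
  -- `n ≥ 4`: splice `x` out of the rim
  set σ' : Equiv.Perm V := Equiv.swap x (σ x) * σ with hσ'
  have hσ'c : σ'.IsCycle := hσ.swap_mul hx hffx
  have hh' : σ' h = h := by
    rw [hσ', Equiv.Perm.mul_apply, hh, Equiv.swap_apply_of_ne_of_ne hxh.symm hbh.symm]
  have hn' : σ'.support.card = n - 1 := by
    rw [hσ', Equiv.Perm.support_swap_mul_eq σ x hffx, Finset.sdiff_singleton_eq_erase,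
      Finset.card_erase_of_mem (Equiv.Perm.mem_support.2 hx), hn]
  have ha' : σ' (σ.symm x) = σ x := by
    rw [hσ', Equiv.Perm.mul_apply, Equiv.apply_symm_apply, Equiv.swap_apply_left]
  have hma : σ' (σ.symm x) ≠ σ.symm x := by rw [ha']; exact hab.symm
  have hb' : σ' (σ x) = σ (σ x) := by
    rw [hσ', Equiv.Perm.mul_apply, Equiv.swap_apply_of_ne_of_ne hffx (apply_ne hx)]
  have hmb : σ' (σ x) ≠ σ x := by rw [hb']; exact apply_ne hx
  have hbsymm : σ'.symm (σ x) = σ.symm x := by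
    rw [Equiv.symm_apply_eq]; exact ha'.symm
  have hsub := wheel_splice_subset h hx hffx
  obtain ⟨IHa, -, -⟩ := ih (n - 1) (by omega) σ' h hσ'c hh' hn' (by omega) (σ.symm x) hma
  obtain ⟨-, IHb, -⟩ := ih (n - 1) (by omega) σ' h hσ'c hh' hn' (by omega) (σ x) hmb
  rw [ha'] at IHa
  rw [hbsymm] at IHb
  refine ⟨?_, ?_, c3⟩
  · -- pair `(x σx, x h)`: third neighbour `σ⁻¹ x`
    refine negCorrPairSupp_of_degree_three hq0 hq1 (u := σ.symm x) hax.symm hbx.symm hxh hab.symm hah.symm hbh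
      (fun e he hxe => ?_) (IHa.mono ?_)
    · rcases hS e he hxe with h1 | h1 | h1
      · exact Or.inl h1
      · exact Or.inr (Or.inr h1)
      · exact Or.inr (Or.inl h1)
    · refine Set.Subset.trans (Set.union_subset_union_right _ ?_) hsub
      intro e he
      rcases he with rfl | rfl
      · exact Or.inl rfl
      · exact Or.inr (Or.inr (Or.inl rfl))
  · -- pair `(x σ⁻¹x, x h)`: third neighbour `σ x`
    refine negCorrPairSupp_of_degree_three hq0 hq1 (u := σ x) hbx.symm hax.symm hxh hab hbh.symm hah
      (fun e he hxe => ?_) (IHb.mono ?_)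
    · rcases hS e he hxe with h1 | h1 | h1
      · exact Or.inr (Or.inr h1)
      · exact Or.inl h1
      · exact Or.inr (Or.inl h1)
    · refine Set.Subset.trans (Set.union_subset_union_right _ ?_) hsub
      intro e he
      rcases he with rfl | rfl
      · exact Or.inr (Or.inl rfl)
      · exact Or.inr (Or.inr (Or.inr rfl))


/-- **ADJACENT-EDGE NEGATIVE CORRELATION AT EVERY RIM VERTEX OF EVERY WHEEL** (`0 < q ≤ 1`, all weights).  Let the wheel have
hub `h` and rim cycle `σ` (`σ.IsCycle`, `σ h = h`, at least three rim vertices), let `x` be a rim vertex and let `e ≠ f` be two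
pairs of the wheel containing `x` (two of `x σx`, `x σ⁻¹x`, `x h`).  Then `φ_{w,q}(J_e ∩ J_f) ≤ φ_{w,q}(J_e)·φ_{w,q}(J_f)` for every
weight vector `w` supported in the wheel.  The wheels `W_n` (`n ≥ 4`) are 3-connected and outside the series–parallel / `K₄`-glued
stock on which edge-negative association is known (Wagner 2008 §5.3, kernel: `edgeNegCorrSupp_of_isTwoTreeK4Glued`); negative
correlation of adjacent edges of `φ_{p,q<1}` on general graphs is open in print (Grimmett 2006 §3.9; Park 2026, p. 1).  Not
covered: the pairs of spokes at the hub. [cite: Grimmett2006, §3.9 eq. (3.94) (p. 63)] [cite: Wagner2006, Ex. 5.1, Thm. 5.8(d), §5.3] -/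
theorem wheel_negCorr_at_rim {q : ℝ} (hq0 : 0 < q) (hq1 : q ≤ 1) {h : V} {σ : Equiv.Perm V} (hσ : σ.IsCycle) (hh : σ h = h)
    (h3 : 3 ≤ σ.support.card) {x : V} (hx : σ x ≠ x) {e f : Sym2 V} (he : e ∈ wheelEdges h σ) (hf : f ∈ wheelEdges h σ)
    (hxe : x ∈ e) (hxf : x ∈ f) (hef : e ≠ f) (w : Sym2 V → unitInterval)
    (hw : ∀ g, ((w g : unitInterval) : ℝ) ≠ 0 → g ∈ wheelEdges h σ) :
    (rcMeasureW w q ∅).real ({ω | e ∈ ω} ∩ {ω | f ∈ ω}) ≤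
      (rcMeasureW w q ∅).real {ω | e ∈ ω} * (rcMeasureW w q ∅).real {ω | f ∈ ω} := by
  obtain ⟨c1, c2, c3⟩ := wheel_negCorr_rim_aux hq0 hq1 _ σ h hσ hh rfl h3 x hx
  rcases eq_of_mem_wheelEdges_of_mem hh hx he hxe with rfl | rfl | rfl <;>
    rcases eq_of_mem_wheelEdges_of_mem hh hx hf hxf with rfl | rfl | rfl
  · exact absurd rfl hef
  · exact c3.symm w hw
  · exact c1 w hw
  · exact c3 w hw
  · exact absurd rfl hef
  · exact c2 w hw
  · exact c1.symm w hw
  · exact c2.symm w hw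
  · exact absurd rfl hef

/-- **The same, for adjacent pairs meeting at a vertex `v` that is not the hub** (so at a rim vertex: the common vertex of two
distinct pairs of a wheel is the hub or a rim vertex). [cite: Grimmett2006, §3.9 eq. (3.94) (p. 63)] [cite: Wagner2006, §5.3] -/
theorem wheel_negCorr_adj_off_hub {q : ℝ} (hq0 : 0 < q) (hq1 : q ≤ 1) {h : V} {σ : Equiv.Perm V} (hσ : σ.IsCycle)
    (hh : σ h = h) (h3 : 3 ≤ σ.support.card) {e f : Sym2 V} (he : e ∈ wheelEdges h σ) (hf : f ∈ wheelEdges h σ) (hef : e ≠ f)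
    {v : V} (hve : v ∈ e) (hvf : v ∈ f) (hvh : v ≠ h) (w : Sym2 V → unitInterval)
    (hw : ∀ g, ((w g : unitInterval) : ℝ) ≠ 0 → g ∈ wheelEdges h σ) :
    (rcMeasureW w q ∅).real ({ω | e ∈ ω} ∩ {ω | f ∈ ω}) ≤
      (rcMeasureW w q ∅).real {ω | e ∈ ω} * (rcMeasureW w q ∅).real {ω | f ∈ ω} := by
  -- a vertex of a wheel pair other than the hub is a rim vertex
  have hv : σ v ≠ v := by
    obtain ⟨u, hu, rfl | rfl⟩ := he
    · rw [Sym2.mem_iff] at hve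
      rcases hve with rfl | rfl
      · exact absurd rfl hvh
      · exact hu
    · rw [Sym2.mem_iff] at hve
      rcases hve with rfl | rfl
      · exact hu
      · exact apply_ne hu
  exact wheel_negCorr_at_rim hq0 hq1 hσ hh h3 hv he hf hve hvf hef w hw

end FK

end Summit.CriticalPhenomena.PercolationContinuityZ3.Theorems

end
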